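import Literature.NumberTheory.GaloisCohomology.Howard2004.CasselsTateSkewPairingOfLevelDecompositionsProofs
import Literature.Algebra.Module.PairedTorsionModulesDVR
import HarnessLib

/-!
# Howard 2004: the typed print leaf C45.1′ (`prop141_casselsTate_skewPairing_atLevel`) and Thm. 1.4.2-as-applied
# (`HasLevelDecompositionsAt`) ⟺ the DATA-FREE PARITY FORM «every elementary divisor `π^s`, `s < e_k`, of
# `H¹_{𝓕(n)}(K, T^{(k)})` has even multiplicity» (Howard: «`V_s/V_{s-1}` is even dimensional») — proofs file

Topic `NumberTheory/GaloisCohomology/Howard2004`. THEOREMS ONLY: no definition, no named fact, no instance, no notation, no `sorry`.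
Cell `pub/bsd-print-x9` (seat x10b-p1-w7 g11, brick «C451-PARITY», `--supports stmt-BirchSwinnertonDyer-22642`; crux of record
stmt-BirchSwinnertonDyer-23055, print leaf G87 = Howard Thm. 1.6.1 ↦ (pen r8) the «Flach leaf» C45.1′). Sequel of
`CasselsTateSkewPairingOfLevelDecompositionsProofs` (C45.1′ ⟺ form (α), this seat) and of the pure algebra
`Literature/Algebra/Module/PairedTorsionModulesDVR.lean` (x10b-p1-w7 g6: Howard's layer
`V_s/V_{s-1} = N[ϖˢ]/(N[ϖ^{s-1}] + ϖN[ϖ^{s+1}])`, `length_torsionLayer_eq_card_of_linearEquiv`,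
`exists_linearEquiv_pi_prod_pi_prod_self_of_even_length_torsionLayer`).

SOURCE. B. Howard, *The Heegner point Kolyvagin system*, Compositio Math. **140** (2004) = arXiv:1202.6340, proof of Thm. 1.4.2
(p0008 L104–L139): «We claim that for `0 ≤ s < k`, the `R/𝔪`-vector space `V_s` [`V_s/V_{s-1}`] is even dimensional. The claim then
follows easily from this and the structure theorem for finitely-generated `R`-modules.» and §1.6 ¶1 (p0011 L40–44: «for `n ∈ 𝓝^{(k)}`
we have a decomposition `H¹_{𝓕(n)}(K, T^{(k)}) ≅ R^{(k),ε} ⊕ M^{(k)}(n) ⊕ M^{(k)}(n)`»).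

WHAT IS PROVED (the `R`-module `𝓗(n)` is `S.selmerModuleAt hy k n` for `galoisCohomology.moduleH1`; the layer is the tree's
`(𝓗(n)[π^{t+1}]) ⧸ (𝓗(n)[π^t] ⊔ π • 𝓗(n)[π^{t+2}])` in `Submodule.torsionBy` currency):
* §1 `even_length_torsionLayer_of_linearEquiv_prod_prod` — the model `(R/ϖ^e)^ε × (M × M)`, `M ≃ Π_i R/(ϖ^{a_i})`, has even
  layers below `e` (reindex over `Fin ε ⊕ (ι ⊕ ι)` and count);
* §2 **`DVRSetting.even_length_torsionLayer_of_hasLevelDecompositionsAt`**, **`…hasLevelDecompositionsAt_of_forall_even_length_torsionLayer`**,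
  **`…hasLevelDecompositionsAt_iff_forall_even_length_torsionLayer`** — on a `DVRSetting` with H.0–H.5, `HasLevelDecompositionsAt` ⟺
  every layer `t + 1 < e_k` of every `𝓗(n)`, `n ∈ 𝓝^{(k)}`, has even length (⇒: `π^{e_k}` kills `M`, Macdonald II (1.3), §1;
  ⇐: `finite_selmerGroup_modify`, the algebraic half of Thm. 1.4.2, `finite_quotient_span_pi_pow`);
* §3 **`prop141_casselsTate_skewPairing_atLevel_iff_forall_even_length_torsionLayer`** — the leaf C45.1′ ⟺ the parity property on
  every setting (composition with `prop141_casselsTate_skewPairing_atLevel_iff_forall_hasLevelDecompositionsAt`).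

READING (numbers, for the desk): the ∃-typed Flach leaf asserts EXACTLY a property of the finite `R`-modules `H¹_{𝓕(n)}(K, T^{(k)})`
(no pairing data): even multiplicity of each elementary divisor `π^s`, `1 ≤ s < e_k`. HONEST FRAMING: neither side is proved here;
Flach's pairing is not constructed; Prop. 1.4.1 / Thm. 1.4.2 / `thm161_dvrKolyvaginBound` are NOT proved; no summit statement is
proved; the Birch–Swinnerton-Dyer conjecture is not proved by any of this.
-/

set_option autoImplicit false

open Function NumberField IsDedekindDomain Field Module Submodule
open scoped NumberField ContRepresentation Pointwise

namespace Literature.NumberTheory.GaloisCohomology.Howard2004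

open Literature.NumberTheory.GaloisRepresentations
open Literature.NumberTheory.GaloisRepresentations.DiscreteGaloisModule
open Literature.Algebra.Module

/-! ## §1 Counting: the model `(R/ϖ^e)^ε × (Π_j R/ϖ^{a_j})²` has an even number of summands of each length `< e` -/

section Counting

variable {R : Type*} [CommRing R] [IsDomain R] [IsDiscreteValuationRing R] {ϖ : R}
  {V : Type*} [AddCommGroup V] [Module R V]

/-- **Even layers of the model.** If `V ≃ₗ[R] (R/ϖ^e)^ε × (M × M)` with `M ≃ₗ[R] Π_{i} R/(ϖ^{a_i})`, then for every
`t + 1 < e` Howard's layer `V[ϖ^{t+1}]/(V[ϖ^t] + ϖ·V[ϖ^{t+2}])` has EVEN length: reindex over `Fin ε ⊕ (ι ⊕ ι)` and count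
the summands of length exactly `t + 1` (`length_torsionLayer_eq_card_of_linearEquiv`) — none among the `R/ϖ^e`, the same
number in each copy of `M`. [cite: Howard2004HeegnerKolyvagin, Thm. 1.4.2 (proof: «V_s/V_{s-1} is even dimensional») (arXiv:1202.6340 p0008 L108–L115)] -/
theorem even_length_torsionLayer_of_linearEquiv_prod_prod (hϖ : Irreducible ϖ) {ε e : ℕ} {ι : Type*} [Fintype ι]
    {a : ι → ℕ} {M : Type*} [AddCommGroup M] [Module R M]
    (Θ : V ≃ₗ[R] ((Fin ε → R ⧸ Ideal.span {ϖ ^ e}) × (M × M)))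
    (g : M ≃ₗ[R] (Π i, R ⧸ Ideal.span {ϖ ^ a i})) (t : ℕ) (ht : t + 1 < e) :
    Even (Module.length R ((↥(torsionBy R V (ϖ ^ (t + 1)))) ⧸ comap (torsionBy R V (ϖ ^ (t + 1))).subtype
        (torsionBy R V (ϖ ^ t) ⊔ ϖ • torsionBy R V (ϖ ^ (t + 2))))) := by
  classical
  -- exponents over the index type `Fin ε ⊕ (ι ⊕ ι)`
  let c : Fin ε ⊕ (ι ⊕ ι) → ℕ := Sum.elim (fun _ ↦ e) (Sum.elim a a)
  -- the reindexing `V ≃ Π_x R/ϖ^{c x}`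
  let E : V ≃ₗ[R] (Π x, R ⧸ Ideal.span {ϖ ^ c x}) :=
    (Θ.trans (LinearEquiv.prodCongr (LinearEquiv.refl R _)
      ((LinearEquiv.prodCongr g g).trans
        (LinearEquiv.sumPiEquivProdPi R ι ι (fun y ↦ R ⧸ Ideal.span {ϖ ^ c (Sum.inr y)})).symm))).trans
      (LinearEquiv.sumPiEquivProdPi R (Fin ε) (ι ⊕ ι) (fun x ↦ R ⧸ Ideal.span {ϖ ^ c x})).symm
  rw [length_torsionLayer_eq_card_of_linearEquiv hϖ E t, Finset.card_filter, Fintype.sum_sum_type,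
    Fintype.sum_sum_type]
  have h1 : ∑ _i : Fin ε, (if c (Sum.inl _i) = t + 1 then 1 else 0) = 0 :=
    Finset.sum_eq_zero fun i _ ↦ if_neg (by show ¬ e = t + 1; omega)
  rw [h1, zero_add]
  refine ⟨(∑ i : ι, (if a i = t + 1 then 1 else 0) : ℕ), ?_⟩
  push_cast
  rfl

end Counting

/-! ## §2 On a `DVRSetting`: `HasLevelDecompositionsAt` ⟺ even layers of every `𝓗(n)` -/

namespace DVRSetting

variable {p : ℕ} [Fact p.Prime] {K : Type} [Field K] [NumberField K]
  {R : Type} [CommRing R] [IsDomain R] [IsDiscreteValuationRing R] [Algebra ℤ_[p] R]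
  {N : ℕ → Type} [∀ k, AddCommGroup (N k)] [∀ k, TopologicalSpace (N k)]
  [∀ k, DiscreteTopology (N k)] [∀ k, Module R (N k)]
  {Rk : ℕ → Type} [∀ k, CommRing (Rk k)] [∀ k, IsLocalRing (Rk k)] [∀ k, TopologicalSpace (Rk k)]
  [∀ k, DiscreteTopology (Rk k)] [∀ k, Algebra ℤ_[p] (Rk k)] [∀ k, Algebra R (Rk k)]
  [∀ k, Module (Rk k) (N k)] [∀ k, IsScalarTower R (Rk k) (N k)]
  {Nbar : Type} [AddCommGroup Nbar] [TopologicalSpace Nbar] [DiscreteTopology Nbar]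
  [∀ k, Module (Rk k) Nbar]
  {Nq : ℕ → Finset (HeightOneSpectrum (𝓞 K)) → Type} [∀ k n, AddCommGroup (Nq k n)]
  [∀ k n, TopologicalSpace (Nq k n)] [∀ k n, DiscreteTopology (Nq k n)]
  [∀ k n, Module (Rk k) (Nq k n)] [∀ k n, Module R (Nq k n)]
  [∀ k n, IsScalarTower R (Rk k) (Nq k n)]

/-- **`HasLevelDecompositionsAt` ⇒ even layers.** If every `𝓗(n) = H¹_{𝓕(n)}(K, T^{(k)})`, `n ∈ 𝓝^{(k)}`, decomposes
`R`-equivariantly as `(R/𝔪^{e_k})^ε × (M × M)` (`M` finite), then for every `t + 1 < e_k` Howard's layer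
`𝓗(n)[π^{t+1}]/(𝓗(n)[π^t] + π·𝓗(n)[π^{t+2}])` (`= V_s/V_{s-1}`, `s = t + 1`) has even length — the multiplicity of the
elementary divisor `π^{t+1}` of the `R`-module `𝓗(n)` (`S.selmerModuleAt hy k n`) is even.
[cite: Howard2004HeegnerKolyvagin, Thm. 1.4.2 (proof: «V_s/V_{s-1} is even dimensional for every 1 ≤ s < k») and §1.6 ¶1 (arXiv:1202.6340 p0008 L108–L139, p0011 L40–44)] -/
theorem even_length_torsionLayer_of_hasLevelDecompositionsAt (S : DVRSetting p K R N Rk Nbar Nq)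
    (hy : S.SatisfiesH) (hdec : S.HasLevelDecompositionsAt hy) (k : ℕ) (n : Finset (HeightOneSpectrum (𝓞 K)))
    (hn : ↑n ⊆ S.levelPrimes k) (t : ℕ) (ht : t + 1 < S.e k) :
    letI := galoisCohomology.moduleH1 (S.T.ρ k) (S.T.hlin k)
    Even (Module.length R ((↥(torsionBy R ↥(S.selmerModuleAt hy k n) (S.π ^ (t + 1)))) ⧸
      comap (torsionBy R ↥(S.selmerModuleAt hy k n) (S.π ^ (t + 1))).subtype
        (torsionBy R ↥(S.selmerModuleAt hy k n) (S.π ^ t) ⊔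
          S.π • torsionBy R ↥(S.selmerModuleAt hy k n) (S.π ^ (t + 2))))) := by
  classical
  letI modH : Module R (galoisCohomology (S.T.ρ k) 1) := galoisCohomology.moduleH1 (S.T.ρ k) (S.T.hlin k)
  have hπ : Irreducible S.π := (IsDiscreteValuationRing.irreducible_iff_uniformizer S.π).mpr hy.unif
  obtain ⟨ε, -, M, _, _, _, θ, hθ⟩ := hdec k n hn
  -- `θ` as an `R`-linear equivalence on the submodule `𝓗(n)`
  let Θ : ↥(S.selmerModuleAt hy k n) ≃ₗ[R] ((Fin ε → R ⧸ IsLocalRing.maximalIdeal R ^ S.e k) × (M × M)) :=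
    { toFun := fun x ↦ θ ⟨x.1, x.2⟩
      invFun := fun y ↦ ⟨(θ.symm y).1, (θ.symm y).2⟩
      map_add' := fun x y ↦ by
        rw [← map_add]
        rfl
      map_smul' := fun r x ↦ by
        rw [RingHom.id_apply, ← hθ r x.1 x.2]
        rfl
      left_inv := fun x ↦ Subtype.ext (by
        show ((θ.symm (θ ⟨x.1, x.2⟩) : _) : galoisCohomology (S.T.ρ k) 1) = x.1
        rw [AddEquiv.symm_apply_apply])
      right_inv := fun y ↦ by
        show θ ⟨(θ.symm y).1, (θ.symm y).2⟩ = y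
        exact AddEquiv.apply_symm_apply θ y }
  -- `M` is killed by `π^{e_k}`: structure `M ≃ Π_i R/(π^{a_i})`
  have hkill : ∀ y : galoisCohomology (S.T.ρ k) 1,
      galoisCohomology.scalarMapH1 (S.T.ρ k) (S.T.hlin k) (S.π ^ S.e k) y = 0 := fun y ↦
    galoisCohomology.smul_eq_zero_of_forall (S.T.ρ k) (S.T.hlin k) _
      (fun mm ↦ hy.killed k _ (Ideal.pow_mem_pow (S.π_mem_maximalIdeal hy) _) mm) y
  have hMkill : ∀ mm : M, S.π ^ S.e k • mm = 0 := by
    intro mm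
    obtain ⟨y, hy'⟩ := θ.surjective (0, (mm, 0))
    have h1 := hθ (S.π ^ S.e k) y.1 y.2
    have h2 : (⟨galoisCohomology.scalarMapH1 (S.T.ρ k) (S.T.hlin k) (S.π ^ S.e k) y.1,
        S.scalarMapH1_mem_selmerGroup_atLevel hy k n (S.π ^ S.e k) y.2⟩ :
          ↥(((S.t k).atLevel S.jbar n).cond).selmerGroup) = 0 := Subtype.ext (hkill y.1)
    rw [h2, map_zero, show (⟨y.1, y.2⟩ : ↥(((S.t k).atLevel S.jbar n).cond).selmerGroup) = y from rfl,
      hy'] at h1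
    have h3 := congr_arg (fun q ↦ q.2.1) h1
    simpa only [Prod.snd_zero, Prod.fst_zero, Prod.smul_snd, Prod.smul_fst] using h3.symm
  have hMtors : Module.IsTorsion R M := fun mm ↦
    ⟨⟨S.π ^ S.e k, mem_nonZeroDivisors_of_ne_zero (pow_ne_zero _ hπ.ne_zero)⟩, hMkill mm⟩
  obtain ⟨m, a, -, -, ⟨g⟩⟩ := exists_linearEquiv_pi_quotient_uniformizer_pow_of_isTorsion hπ M hMtors
  -- reindex the free part along `𝔪^{e_k} = (π^{e_k})` and count
  have he : IsLocalRing.maximalIdeal R ^ S.e k = Ideal.span {S.π ^ S.e k} := by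
    rw [hy.unif, Ideal.span_singleton_pow]
  let Θ' : ↥(S.selmerModuleAt hy k n) ≃ₗ[R] ((Fin ε → R ⧸ Ideal.span {S.π ^ S.e k}) × (M × M)) :=
    Θ.trans (LinearEquiv.prodCongr (LinearEquiv.piCongrRight fun _ ↦ Submodule.quotEquivOfEq _ _ he)
      (LinearEquiv.refl R _))
  exact even_length_torsionLayer_of_linearEquiv_prod_prod hπ Θ' g t ht

/-- **Even layers ⇒ `HasLevelDecompositionsAt`** (the algebraic half of Thm. 1.4.2, `PairedTorsionModulesDVR`:
«the claim then follows easily from this and the structure theorem», with `ε ∈ {0,1}`): if for every level `k`, every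
`n ∈ 𝓝^{(k)}` and every `t + 1 < e_k` the layer `𝓗(n)[π^{t+1}]/(𝓗(n)[π^t] + π·𝓗(n)[π^{t+2}])` has even length, then every
`𝓗(n)` is `R`-equivariantly `≃ (R/𝔪^{e_k})^ε × (M × M)` with `ε ≤ 1`, `M = Π_j R/(π^{n_j})` finite.
[cite: Howard2004HeegnerKolyvagin, Thm. 1.4.2 (proof) and §1.6 ¶1 (arXiv:1202.6340 p0008 L100–L139, p0011 L40–44)] -/
theorem hasLevelDecompositionsAt_of_forall_even_length_torsionLayer (S : DVRSetting p K R N Rk Nbar Nq)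
    (hy : S.SatisfiesH)
    (h : ∀ (k : ℕ) (n : Finset (HeightOneSpectrum (𝓞 K))), ↑n ⊆ S.levelPrimes k → ∀ t : ℕ, t + 1 < S.e k →
      letI := galoisCohomology.moduleH1 (S.T.ρ k) (S.T.hlin k)
      Even (Module.length R ((↥(torsionBy R ↥(S.selmerModuleAt hy k n) (S.π ^ (t + 1)))) ⧸
        comap (torsionBy R ↥(S.selmerModuleAt hy k n) (S.π ^ (t + 1))).subtype
          (torsionBy R ↥(S.selmerModuleAt hy k n) (S.π ^ t) ⊔
            S.π • torsionBy R ↥(S.selmerModuleAt hy k n) (S.π ^ (t + 2)))))) :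
    S.HasLevelDecompositionsAt hy := by
  classical
  intro k n hn
  letI modH : Module R (galoisCohomology (S.T.ρ k) 1) := galoisCohomology.moduleH1 (S.T.ρ k) (S.T.hlin k)
  have hsmul : ∀ (r : R) (x : galoisCohomology (S.T.ρ k) 1),
      r • x = galoisCohomology.scalarMapH1 (S.T.ρ k) (S.T.hlin k) r x := fun _ _ ↦ rfl
  have hπ : Irreducible S.π := (IsDiscreteValuationRing.irreducible_iff_uniformizer S.π).mpr hy.unif
  have hLL : ∀ x : galoisCohomology (S.T.ρ k) 1,
      x ∈ S.selmerModuleAt hy k n ↔ x ∈ (((S.t k).atLevel S.jbar n).cond).selmerGroup := fun x ↦ Iff.rfl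
  haveI : Module.Finite R ↥(S.selmerModuleAt hy k n) := by
    haveI : Finite ↥(((S.t k).atLevel S.jbar n).cond).selmerGroup := S.finite_selmerGroup_modify hy k ∅ ∅ n
    haveI : Finite ↥(S.selmerModuleAt hy k n) :=
      Finite.of_equiv _ (Equiv.subtypeEquivRight (fun x ↦ (hLL x).symm))
    exact Module.Finite.of_finite
  have hk : ∀ x : ↥(S.selmerModuleAt hy k n), S.π ^ S.e k • x = 0 := fun x ↦ Subtype.ext (by
    rw [Submodule.coe_smul, Submodule.coe_zero]
    exact galoisCohomology.smul_eq_zero_of_forall (S.T.ρ k) (S.T.hlin k) _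
      (fun mm ↦ hy.killed k _ (Ideal.pow_mem_pow (S.π_mem_maximalIdeal hy) _) mm) _)
  obtain ⟨ε, m, nj, hε, -, ⟨e⟩⟩ :=
    exists_linearEquiv_pi_prod_pi_prod_self_of_even_length_torsionLayer hπ hk (h k n hn)
  have he : Ideal.span {S.π ^ S.e k} = IsLocalRing.maximalIdeal R ^ S.e k := by
    rw [hy.unif, Ideal.span_singleton_pow]
  let e' : ↥(S.selmerModuleAt hy k n) ≃ₗ[R] ((Fin ε → R ⧸ IsLocalRing.maximalIdeal R ^ S.e k) ×
      ((Π j, R ⧸ Ideal.span {S.π ^ nj j}) × (Π j, R ⧸ Ideal.span {S.π ^ nj j}))) :=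
    e.trans (LinearEquiv.prodCongr (LinearEquiv.piCongrRight fun _ ↦ Submodule.quotEquivOfEq _ _ he)
      (LinearEquiv.refl R _))
  let ι : ↥(((S.t k).atLevel S.jbar n).cond).selmerGroup ≃+ ↥(S.selmerModuleAt hy k n) :=
    { toFun := fun y ↦ ⟨(y : galoisCohomology (S.T.ρ k) 1), (hLL _).2 y.2⟩
      invFun := fun x ↦ ⟨(x : galoisCohomology (S.T.ρ k) 1), (hLL _).1 x.2⟩
      left_inv := fun _ ↦ rfl
      right_inv := fun _ ↦ rfl
      map_add' := fun _ _ ↦ rfl }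
  haveI : ∀ i : Fin m, Finite (R ⧸ Ideal.span {S.π ^ nj i}) := fun i ↦ S.finite_quotient_span_pi_pow hy (nj i)
  refine ⟨ε, hε, (Π j, R ⧸ Ideal.span {S.π ^ nj j}), inferInstance, inferInstance, inferInstance,
    ι.trans e'.toAddEquiv, fun r y hy' ↦ ?_⟩
  have h1 : ι ⟨galoisCohomology.scalarMapH1 (S.T.ρ k) (S.T.hlin k) r y,
      S.scalarMapH1_mem_selmerGroup_atLevel hy k n r hy'⟩ = r • ι ⟨y, hy'⟩ :=
    Subtype.ext (by rw [Submodule.coe_smul, hsmul]; rfl)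
  rw [AddEquiv.trans_apply, AddEquiv.trans_apply, h1, LinearEquiv.coe_toAddEquiv]
  exact map_smul e' r _

/-- **`HasLevelDecompositionsAt` ⟺ EVEN LAYERS (data-free form of Thm. 1.4.2-as-applied).**
[cite: Howard2004HeegnerKolyvagin, Thm. 1.4.2 (proof) and §1.6 ¶1 (arXiv:1202.6340 p0008 L100–L139, p0011 L40–44)] -/
theorem hasLevelDecompositionsAt_iff_forall_even_length_torsionLayer (S : DVRSetting p K R N Rk Nbar Nq)
    (hy : S.SatisfiesH) :
    S.HasLevelDecompositionsAt hy ↔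
      ∀ (k : ℕ) (n : Finset (HeightOneSpectrum (𝓞 K))), ↑n ⊆ S.levelPrimes k → ∀ t : ℕ, t + 1 < S.e k →
        letI := galoisCohomology.moduleH1 (S.T.ρ k) (S.T.hlin k)
        Even (Module.length R ((↥(torsionBy R ↥(S.selmerModuleAt hy k n) (S.π ^ (t + 1)))) ⧸
          comap (torsionBy R ↥(S.selmerModuleAt hy k n) (S.π ^ (t + 1))).subtype
            (torsionBy R ↥(S.selmerModuleAt hy k n) (S.π ^ t) ⊔
              S.π • torsionBy R ↥(S.selmerModuleAt hy k n) (S.π ^ (t + 2))))) :=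
  ⟨fun hdec k n hn t ht ↦ S.even_length_torsionLayer_of_hasLevelDecompositionsAt hy hdec k n hn t ht,
    fun h ↦ S.hasLevelDecompositionsAt_of_forall_even_length_torsionLayer hy h⟩

end DVRSetting

/-! ## §3 The leaf C45.1′ in parity form -/

/-- **THE FLACH LEAF IN DATA-FREE FORM.** The typed print leaf C45.1′ `prop141_casselsTate_skewPairing_atLevel` (Howard
Prop. 1.4.1 / Flach 1990 with the displays (i)(ii) of the proof of Thm. 1.4.2, ∃-typed on every `𝓗(n) = H¹_{𝓕(n)}(K, T^{(k)})`)
holds IF AND ONLY IF: on every `DVRSetting` with H.0–H.5, for every level `k`, every `n ∈ 𝓝^{(k)}` and every `1 ≤ s < e_k`,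
the multiplicity of the elementary divisor `π^s` of the finite `R`-module `H¹_{𝓕(n)}(K, T^{(k)})` is EVEN (Howard, proof of
Thm. 1.4.2: «the `R/𝔪`-vector space `V_s/V_{s-1}` is even dimensional for every `1 ≤ s < k`») — here as the length of the
layer `𝓗(n)[π^{t+1}]/(𝓗(n)[π^t] + π·𝓗(n)[π^{t+2}])`, `t + 1 < e_k`.  Composition of
`prop141_casselsTate_skewPairing_atLevel_iff_forall_hasLevelDecompositionsAt` (C45.1′ ⟺ form (α)) with
`hasLevelDecompositionsAt_iff_forall_even_length_torsionLayer`.  Neither side is proved; BSD is not proved by this.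
[cite: Howard2004HeegnerKolyvagin, Prop. 1.4.1, Thm. 1.4.2 (with proof) and §1.6 ¶1 (arXiv:1202.6340 p0008 L83–L142, p0011 L33–44)] -/
theorem prop141_casselsTate_skewPairing_atLevel_iff_forall_even_length_torsionLayer :
    prop141_casselsTate_skewPairing_atLevel ↔
    ∀ (p : ℕ) [Fact p.Prime] (K : Type) [Field K] [NumberField K]
      (R : Type) [CommRing R] [IsDomain R] [IsDiscreteValuationRing R] [Algebra ℤ_[p] R]
      (N : ℕ → Type) [∀ k, AddCommGroup (N k)] [∀ k, TopologicalSpace (N k)]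
      [∀ k, DiscreteTopology (N k)] [∀ k, Module R (N k)]
      (Rk : ℕ → Type) [∀ k, CommRing (Rk k)] [∀ k, IsLocalRing (Rk k)] [∀ k, TopologicalSpace (Rk k)]
      [∀ k, DiscreteTopology (Rk k)] [∀ k, Algebra ℤ_[p] (Rk k)] [∀ k, Algebra R (Rk k)]
      [∀ k, Module (Rk k) (N k)] [∀ k, IsScalarTower R (Rk k) (N k)]
      (Nbar : Type) [AddCommGroup Nbar] [TopologicalSpace Nbar] [DiscreteTopology Nbar]
      [∀ k, Module (Rk k) Nbar]
      (Nq : ℕ → Finset (HeightOneSpectrum (𝓞 K)) → Type) [∀ k n, AddCommGroup (Nq k n)]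
      [∀ k n, TopologicalSpace (Nq k n)] [∀ k n, DiscreteTopology (Nq k n)]
      [∀ k n, Module (Rk k) (Nq k n)] [∀ k n, Module R (Nq k n)]
      [∀ k n, IsScalarTower R (Rk k) (Nq k n)]
      (S : DVRSetting p K R N Rk Nbar Nq) (hy : S.SatisfiesH),
      ∀ (k : ℕ) (n : Finset (HeightOneSpectrum (𝓞 K))), ↑n ⊆ S.levelPrimes k → ∀ t : ℕ, t + 1 < S.e k →
        letI := galoisCohomology.moduleH1 (S.T.ρ k) (S.T.hlin k)
        Even (Module.length R ((↥(torsionBy R ↥(S.selmerModuleAt hy k n) (S.π ^ (t + 1)))) ⧸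
          comap (torsionBy R ↥(S.selmerModuleAt hy k n) (S.π ^ (t + 1))).subtype
            (torsionBy R ↥(S.selmerModuleAt hy k n) (S.π ^ t) ⊔
              S.π • torsionBy R ↥(S.selmerModuleAt hy k n) (S.π ^ (t + 2))))) := by
  rw [prop141_casselsTate_skewPairing_atLevel_iff_forall_hasLevelDecompositionsAt]
  refine ⟨fun h _ _ _ _ _ _ _ _ _ _ _ _ _ _ _ _ _ _ _ _ _ _ _ _ _ _ _ _ _ _ _ _ _ _ _ _ S hy ↦
      (S.hasLevelDecompositionsAt_iff_forall_even_length_torsionLayer hy).1 (h _ _ _ _ _ _ _ S hy),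
    fun h _ _ _ _ _ _ _ _ _ _ _ _ _ _ _ _ _ _ _ _ _ _ _ _ _ _ _ _ _ _ _ _ _ _ _ _ S hy ↦
      (S.hasLevelDecompositionsAt_iff_forall_even_length_torsionLayer hy).2 (h _ _ _ _ _ _ _ S hy)⟩

end Literature.NumberTheory.GaloisCohomology.Howard2004
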